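/-
COR-CM (cell pub-hodgecm2, stage 2 of the Hodge ladder) — count-neutral KERNEL COMBINATORICS «β − 1 generating rank-four faces for every Galois CM field of
twist type ℤ/2n × B, all n ≥ 2 at once» (seat prover-pub-hodgecm2-b09-g36-0, binder prover b09, gen 36; claim UNIFORM TWIST GENERATION, HOME/INBOX.md
l.13513 / INTERIM #1 l.14287).  Theorems only; no geometry beyond the tree's `Face` / `faceOfG`, no `Universe` field touched, no named fact, nothing
asserted; this seat's uniform law (`Census/TwistGeneration{Law,Exact}.lean`) and seat b23's generic transfer (`CorCM/FaceGenerationTransfer.lean`) are used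
BY NAME; `Interfaces.lean` (C1), every E term, B01, `Transposition/*`, `PortJoin/*`, `D2Bridge/*` are untouched.
HONEST FRAMING (COORDINATOR RULING — HODGE FRAMING CORRECTION, 2026-08-21T11:55:35Z): `HC_CM` is NOT proved, here or anywhere in the tree; this file
produces no period and proves no face period for any field.
T5: n/a-class — the only Prop hypothesis binders displayed are the datum equations (`θ (P * Q) = θ P + θ Q`, `θ conjT = (n, 0)`), `2 ≤ n`, `3 ≤ |B|`,
`n = 2^j` and the order condition on `B`, INT2-GEN's `hgen` in the floor statements and INT2-GEN's period hypothesis on the produced face set (§3);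
no named-fact / conjecture-def binder; checker: self
(prover-pub-hodgecm2-b09-g36-0), 2026-08-24.
-/
import Summits.HodgeConjecture.CorCM.Census.TwistGenerationExact
import Summits.HodgeConjecture.CorCM.FaceGenerationTransfer
import HarnessLib

/-!
# Galois CM fields of twist type `ℤ/2n × B`: `β − 1` generating rank-four faces for EVERY `n ≥ 2`, and exactly `β − 1` without screw

Let `F` be a Galois CM field whose Galois translates carry a TWIST DATUM of level `n ≥ 2`: a bijection `θ : GalT F ≃ ZMod (2n) × B`, multiplicative-to-
additive, with `θ conjT = (n, 0)` — i.e. `Gal(F/ℚ) = ⟨u⟩ × B` with `u` CENTRAL OF ORDER `2n` and `uⁿ =` complex conjugation (`B` ANY finite group with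
`|B| ≥ 3`; `[F:ℚ] = 2n|B|`).  For `n = 2` these are the quartic-twist fields of `CorCM/FaceQuarticTwistGeneration.lean` (b23 on b09's quartic law); for
`n = 2^j` they are ALL the `2^{j+1}`-ic twists `F = k_{2^{j+1}}·L` (octic, hexadecic, … cyclic CM field `k` times a totally real Galois `L` with group
`B`, linearly disjoint), for which generation was known in the kernel only up to `j = 2` (`Census/OcticTwist*`, 28 files of this lineage).
Write `β(F) = #Block conjT` (↔ the simple CM isogeny classes split by `F`).

* §1 **`exists_faces_hgen_of_twist`** (every `n ≥ 2`): for every base embedding `σ₀` there is a finite set `𝒮` of rank-four faces of `F` with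
  **`|𝒮| + 1 ≤ β(F)`** satisfying INT2-GEN's generation binder `hgen(𝒮, σ₀)` — the field form of `Census.TwistGeneration.exists_gfaces_generate` through
  `FaceTransfer.exists_faces_hgen_of_generate`.
* §2 (`n = 2^j`) **`isLeast_card_faces_hgen_of_twist_noScrew`**: if no element of `B` has order divisible by `2n`, the least size of a face set with
  `hgen(𝒮, σ₀)` is EXACTLY **`β(F) − 1`** (`Census.TwistGeneration.exact_law_noScrew` through `FaceTransfer.isLeast_card_faces_hgen_of_intrinsic`);
  **`card_faces_sandwich_of_twist_screw`**: otherwise every such face set has `β(F) ≤ |𝒮| + 2` and one with `|𝒮| + 1 ≤ β(F)` exists.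
* §3 the degree `[F:ℚ] = 2n|B| ≥ 12` and **`hodgeConjectureFor_of_twist_of_exists_facePeriod`** (INT2-GEN socket BY NAME): a face set with `|𝒮| + 1 ≤ β(K)`
  EXISTS whose periods on the universe of record give the Hodge conjecture for every abelian variety dominated by a product of CM abelian varieties with
  CM by subfields of `K` — CONDITIONAL on those periods; `HC_CM` is NOT proved.

References: [cite: Pohlmann1968, Thm. 1]; [cite: Milne1999LefschetzClasses, Thm. 3.2, Prop. 2.1]; [cite: Shimura1998, §6.2 Theorem 3 and §6.1
Corollary of Theorem 2 (pp. 41–43), §8.1 (p. 62)]; [cite: MumfordAV1970, §19 Thm. 1 and p. 169].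
-/

noncomputable section

open CategoryTheory NumberField NumberField.ComplexEmbedding
open Literature.AlgebraicGeometry Literature.AlgebraicGeometry.Motives Literature.AlgebraicGeometry.HodgeTheory
open Literature.AlgebraicGeometry.ComplexMultiplication Literature.AlgebraicGeometry.Milne1999
open Literature.NumberTheory.Automorphic
open Literature.NumberTheory.Automorphic.PicardCM
open Summit.HodgeConjecture.CorCM.Domination

namespace Summit.HodgeConjecture.CorCM.FaceTwist

open Summit.HodgeConjecture.CorCM.Prior.AllgGroup.RfwfAllgGroup
open Summit.HodgeConjecture.CorCM.Census.BlockParity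
open Summit.HodgeConjecture.CorCM.Census.Coinvariant
open Summit.HodgeConjecture.CorCM.Census

variable {F : Type} [Field F] [NumberField F]
variable {B : Type} [AddGroup B] [Fintype B] [DecidableEq B]
variable {n : ℕ} [NeZero n]

/-! ## §1 Every level `n ≥ 2`: `β(F) − 1` generating faces -/

/-- **EVERY GALOIS CM FIELD OF TWIST TYPE `ℤ/2n × B` HAS AT MOST `β − 1` GENERATING FACES.**  For `F` Galois CM with a twist datum
`θ : GalT F ≃ ZMod (2n) × B` (`θ (PQ) = θ P + θ Q`, `θ conjT = (n, 0)`, `n ≥ 2`, `|B| ≥ 3`) and any base embedding `σ₀`: a finite set `𝒮` of rank-four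
faces with `|𝒮| + 1 ≤ β(F) = #Block conjT` and `hgen(𝒮, σ₀)`. [folklore] -/
theorem exists_faces_hgen_of_twist [IsCMField F] [IsGalois ℚ F] (θ : GalT F ≃ ZMod (2 * n) × B)
    (hθ : ∀ P Q : GalT F, θ (P * Q) = θ P + θ Q) (hθc : θ conjT = (((n : ℕ) : ZMod (2 * n)), 0)) (hn : 2 ≤ n) (h3 : 3 ≤ Fintype.card B)
    (σ₀ : F →+* ℂ) :
    ∃ 𝒮 : Finset (Face F), 𝒮.card + 1 ≤ Fintype.card (Block (conjT : GalT F)) ∧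
      ∀ f : Face F, lefChar f.corner (fun _ => ({σ₀} : Finset (F →+* ℂ))) ∈ AddSubgroup.closure
        {a : Asym F | ∃ g ∈ (𝒮 : Set (Face F)), ∃ σ : F →+* ℂ, a = lefChar g.corner (fun _ => ({σ} : Finset (F →+* ℂ)))} := by
  obtain ⟨S, hS, hcard, hgenr⟩ := TwistGeneration.exists_gfaces_generate θ hθ hθc conjT_mul_self hn h3
  obtain ⟨𝒮, h𝒮card, hgen⟩ := FaceTransfer.exists_faces_hgen_of_generate σ₀ S hS hgenr
  exact ⟨𝒮, by omega, hgen⟩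

/-! ## §2 The levels `n = 2^j`: exactly `β(F) − 1` without screw, `β(F) − 2 ≤ · ≤ β(F) − 1` with screw -/

/-- **NO SCREW: EXACTLY `β(F) − 1` GENERATING FACES.**  `n = 2^j ≥ 2`, `|B| ≥ 3`, no element of `B` of (additive) order divisible by `2n` (every odd `|B|`,
…): the least size of a face set `𝒮` with `hgen(𝒮, σ₀)` is EXACTLY `β(F) − 1`, for every base embedding `σ₀`. [folklore] -/
theorem isLeast_card_faces_hgen_of_twist_noScrew [IsCMField F] [IsGalois ℚ F] (θ : GalT F ≃ ZMod (2 * n) × B)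
    (hθ : ∀ P Q : GalT F, θ (P * Q) = θ P + θ Q) (hθc : θ conjT = (((n : ℕ) : ZMod (2 * n)), 0)) {j : ℕ} (hj : n = 2 ^ j) (hn : 2 ≤ n)
    (h3 : 3 ≤ Fintype.card B) (hns : ∀ b : B, ¬ 2 * n ∣ addOrderOf b) (σ₀ : F →+* ℂ) :
    IsLeast {m : ℕ | ∃ 𝒮 : Finset (Face F), 𝒮.card = m ∧
      ∀ f : Face F, lefChar f.corner (fun _ => ({σ₀} : Finset (F →+* ℂ))) ∈ AddSubgroup.closure
        {a : Asym F | ∃ g ∈ (𝒮 : Set (Face F)), ∃ σ : F →+* ℂ, a = lefChar g.corner (fun _ => ({σ} : Finset (F →+* ℂ)))}}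
      (Fintype.card (Block (conjT : GalT F)) - 1) := by
  obtain ⟨⟨S, hS, hcard, hgenr⟩, hfloor⟩ := TwistGeneration.exact_law_noScrew θ hθ hθc conjT_mul_self hj hn h3 hns
  refine FaceTransfer.isLeast_card_faces_hgen_of_intrinsic _ ⟨S, hS, by omega, hgenr⟩ (fun S₀ hS₀ hgen₀ => ?_) σ₀
  have h := hfloor S₀ hS₀ fun y hy => hgen₀ (gfaceSet_subset_hodgeSpan _ _ hy)
  omega

/-- **Existence with the exact count, no screw**: a face set `𝒮` with `|𝒮| + 1 = β(F)` and `hgen(𝒮, σ₀)`. [folklore] -/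
theorem exists_faces_hgen_card_of_twist_noScrew [IsCMField F] [IsGalois ℚ F] (θ : GalT F ≃ ZMod (2 * n) × B)
    (hθ : ∀ P Q : GalT F, θ (P * Q) = θ P + θ Q) (hθc : θ conjT = (((n : ℕ) : ZMod (2 * n)), 0)) {j : ℕ} (hj : n = 2 ^ j) (hn : 2 ≤ n)
    (h3 : 3 ≤ Fintype.card B) (hns : ∀ b : B, ¬ 2 * n ∣ addOrderOf b) (σ₀ : F →+* ℂ) :
    ∃ 𝒮 : Finset (Face F), 𝒮.card + 1 = Fintype.card (Block (conjT : GalT F)) ∧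
      ∀ f : Face F, lefChar f.corner (fun _ => ({σ₀} : Finset (F →+* ℂ))) ∈ AddSubgroup.closure
        {a : Asym F | ∃ g ∈ (𝒮 : Set (Face F)), ∃ σ : F →+* ℂ, a = lefChar g.corner (fun _ => ({σ} : Finset (F →+* ℂ)))} := by
  obtain ⟨⟨𝒮, hcard, hgen⟩, -⟩ := isLeast_card_faces_hgen_of_twist_noScrew θ hθ hθc hj hn h3 hns σ₀
  obtain ⟨S, -, hS, -⟩ := TwistGeneration.exists_gfaces_generate θ hθ hθc conjT_mul_self hn h3
  exact ⟨𝒮, by omega, hgen⟩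

/-- **SCREW: `β(F) − 2 ≤ · ≤ β(F) − 1`.**  `n = 2^j ≥ 2`, `|B| ≥ 3`, some element of `B` of order divisible by `2n`: a face set with `|𝒮| + 1 ≤ β(F)` and
`hgen(𝒮, σ₀)` exists, and every face set with `hgen(𝒮, σ₀)` has `β(F) ≤ |𝒮| + 2`. [folklore] -/
theorem card_faces_sandwich_of_twist_screw [IsCMField F] [IsGalois ℚ F] (θ : GalT F ≃ ZMod (2 * n) × B)
    (hθ : ∀ P Q : GalT F, θ (P * Q) = θ P + θ Q) (hθc : θ conjT = (((n : ℕ) : ZMod (2 * n)), 0)) {j : ℕ} (hj : n = 2 ^ j) (hn : 2 ≤ n)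
    (h3 : 3 ≤ Fintype.card B) (hs : ∃ b : B, 2 * n ∣ addOrderOf b) (σ₀ : F →+* ℂ) :
    (∃ 𝒮 : Finset (Face F), 𝒮.card + 1 ≤ Fintype.card (Block (conjT : GalT F)) ∧
      ∀ f : Face F, lefChar f.corner (fun _ => ({σ₀} : Finset (F →+* ℂ))) ∈ AddSubgroup.closure
        {a : Asym F | ∃ g ∈ (𝒮 : Set (Face F)), ∃ σ : F →+* ℂ, a = lefChar g.corner (fun _ => ({σ} : Finset (F →+* ℂ)))}) ∧
    ∀ 𝒮 : Finset (Face F), (∀ f : Face F, lefChar f.corner (fun _ => ({σ₀} : Finset (F →+* ℂ))) ∈ AddSubgroup.closure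
        {a : Asym F | ∃ g ∈ (𝒮 : Set (Face F)), ∃ σ : F →+* ℂ, a = lefChar g.corner (fun _ => ({σ} : Finset (F →+* ℂ)))}) →
      Fintype.card (Block (conjT : GalT F)) ≤ 𝒮.card + 2 := by
  obtain ⟨-, hfloor⟩ := TwistGeneration.sandwich_screw θ hθ hθc conjT_mul_self hj hn h3 hs
  refine ⟨exists_faces_hgen_of_twist θ hθ hθc hn h3 σ₀, fun 𝒮 hgen => ?_⟩
  have h := FaceTransfer.le_card_of_hgen_of_floor (Fintype.card (Block (conjT : GalT F)) - 2)
    (fun S₀ hS₀ hgen₀ => by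
      have h := hfloor S₀ hS₀ fun y hy => hgen₀ (gfaceSet_subset_hodgeSpan _ _ hy)
      omega) 𝒮 σ₀ hgen
  omega

/-! ## §3 The degree, and the Hodge-conjecture reading through the INT2-GEN socket (conditional on the face periods) -/

omit [AddGroup B] [DecidableEq B] in
/-- **The degree of a twist field of level `n` over `B` is `2n|B|`.** [folklore] -/
theorem finrank_eq_two_mul_mul_card [IsGalois ℚ F] (θ : GalT F ≃ ZMod (2 * n) × B) : Module.finrank ℚ F = 2 * n * Fintype.card B := by
  rw [← FaceCensus.card_galT, Fintype.card_congr θ, Fintype.card_prod, ZMod.card]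

omit [AddGroup B] [DecidableEq B] in
/-- A twist field of level `n ≥ 2` over `B` with `|B| ≥ 3` has degree at least `12`. [folklore] -/
theorem twelve_le_finrank [IsGalois ℚ F] (θ : GalT F ≃ ZMod (2 * n) × B) (hn : 2 ≤ n) (h3 : 3 ≤ Fintype.card B) : 12 ≤ Module.finrank ℚ F := by
  rw [finrank_eq_two_mul_mul_card θ]
  calc 12 = 2 * 2 * 3 := by norm_num
    _ ≤ 2 * n * Fintype.card B := Nat.mul_le_mul (Nat.mul_le_mul_left 2 hn) h3

/-- **HC for the slice of a Galois CM field of twist type from `β − 1` face periods** (INT2-GEN socket BY NAME; CONDITIONAL on the periods —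
`HC_CM` is NOT proved): for `K` Galois CM with a twist datum `θ : GalT K ≃ ZMod (2n) × B` (`n ≥ 2`, `|B| ≥ 3`) there is a face set `𝒮` with
`|𝒮| + 1 ≤ β(K)` such that, if every face of `𝒮` has a non-vanishing period on the universe of record, the Hodge conjecture holds for every abelian
variety dominated by a product of CM abelian varieties with CM by subfields of `K`.
[cite: Shimura1998, §6.2 Theorem 3 and §6.1 Corollary of Theorem 2 (pp. 41–43)] [cite: Pohlmann1968, Thm. 1]
[cite: Milne1999LefschetzClasses, Thm. 3.2 and Cor. 4.5] [cite: MumfordAV1970, §19 Thm. 1 and p. 169] -/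
theorem hodgeConjectureFor_of_twist_of_exists_facePeriod (K : CMField) [hGal : IsGalois ℚ K] (θ : GalT K ≃ ZMod (2 * n) × B)
    (hθ : ∀ P Q : GalT K, θ (P * Q) = θ P + θ Q) (hθc : θ conjT = (((n : ℕ) : ZMod (2 * n)), 0)) (hn : 2 ≤ n) (h3 : 3 ≤ Fintype.card B)
    (σ₀ : (K : Type) →+* ℂ) :
    ∃ 𝒮 : Finset (Face K), 𝒮.card + 1 ≤ Fintype.card (Block (conjT : GalT K)) ∧
      ((∀ f ∈ 𝒮, ∃ ι₁ : K →+* ℂ, f.Admissible ι₁ ∧ ∃ (V : HermSpace3 K ι₁) (σ : K →+* ℂ),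
        (Model.picardCMUniverse exists_isReal_hodgeModel_holds hodgePQ_independent_of_hodgeModel_holds
          BallQuotient.ballQuotientUniformised_holds cmAbelianVarietyRealised_holds).PeriodNV ι₁ V K f.psi σ) →
      ∀ {P A : AbelianVariety ℂ}, AbelianVariety.IsProductOf (fun A : AbelianVariety ℂ =>
        ∃ (E : Type) (_ : Field E) (_ : NumberField E) (_ : IsCMField E) (_ : E →+* (K : Type)) (Φ : CMType E)
          (ι : 𝓞 E →+* End A) (ϑ : E →+* Module.End ℂ (complexBetti A.X 1)),
          IsCMTypeRealisation Φ A ι ϑ) P →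
      AVDominatedBy A P → HodgeConjectureFor A.dim A.X) := by
  obtain ⟨𝒮, hcard, hgen⟩ := exists_faces_hgen_of_twist (F := K) θ hθ hθc hn h3 σ₀
  refine ⟨𝒮, hcard, fun h P A hP hA => ?_⟩
  exact hodgeConjectureFor_of_avDominatedBy_isProductOf_of_exists_facePeriod_on K
    ((twelve_le_finrank (F := K) θ hn h3).trans' (by norm_num)) (𝒮 : Set (Face K)) σ₀ hgen (fun f hf => h f (Finset.mem_coe.mp hf)) hP hA

end Summit.HodgeConjecture.CorCM.FaceTwist

end
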